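import Summits.Parity.GeneralizedHardyLittlewood.Theorems.PrimeLevelFamEdgeMomentsBeyondDiagonalDiagLines
import Summits.Parity.GeneralizedHardyLittlewood.Theorems.PrimeLevelFamEdgeMomentsBeyondDiagonalDiagLineSum
import HarnessLib

/-!
# Route `PrimeLevelFamEdge`, crux K_A `MomentsBeyondDiagonal` (stmt-Parity-20007), line «petersson_layers» v4,
# registered stub `stub_diag : SubDiag` — `diagPart` = EXPLICIT LINE SERIES minus EXPLICIT BOX TAIL (every order, every `Q`)

Composition of `…DiagLines` (p810970: `diagPart` in KMV (23) line coordinates, box kept; closed real form of the order-`(i,j)`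
weight along a line) with `…DiagLineSum` (p811070: the exact `t`-summation into the Bose-type double integral). Per mollifier pair
`(m₁, m₂)` and Hecke divisors `d₁ ∣ m₁`, `d₂ ∣ m₂` write `c = gcd(m₁/d₁, m₂/d₂)`, `e₁ = (m₂/d₂)/c`, `e₂ = (m₁/d₁)/c`, `K = (m₁/c)(m₂/c)`,
`A_ν = log(q̂/(d_ν e_ν))`, `y = K/q̂²`, `g(t) = t⁻¹ 𝒲_{ij}(A₁ − log t, A₂ − log t; y t²)` (`𝒲_{ij} = KMV2000.logCutoffW i j`).

* §1 `lineBox_eq_Icc` — the box condition on the line parameter is an interval: `{1 ≤ t ≤ N : d₁e₁t ≤ N, d₂e₂t ≤ N} = [1, T⋆]`,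
  `T⋆ = min(N/(d₁e₁), N/(d₂e₂))`.
* §2 `sum_Icc_add_tsum_eq_bose` — `Σ_{1 ≤ t ≤ T} g(t) + Σ'_{l ≥ 0} g(l + 1 + T) = 𝔚_{ij}(A₁, A₂; y)`,
  `𝔚_{ij}(A₁,A₂;y) = ∫_{u₁>0}(A₁+log u₁)^i ∫_{u₂>y/u₁} e^{−φ}(1−e^{−φ})^{−2}(A₂+log u₂)^j` (`φ = u₁+u₂`; `y > 0`).
* §3 `diagPart_eq_lineSeries_sub_tail` — **the diagonal part is the explicit line series minus the explicit box tail**: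
  `diagPart q P Q Δ' = Σ_{i,j} QᵢQⱼℓ^{−(i+j)}(1+(−1)^{i+j}) q̂ Σ_{m₁,m₂ ≤ M} x_{m₁}x_{m₂} Σ_{d₁∣m₁,d₂∣m₂} c (m₁m₂)^{−1/2}
     · ( 𝔚_{ij}(A₁,A₂;y) − Σ'_{l ≥ 0} g(l + 1 + T⋆) )`, `T⋆ = min(q²/(d₁e₁), q²/(d₂e₂))`.
  The tail is super-polynomially small in `q` (Rankin, `KMV2000.abs_logCutoffW_le`: `y(l+1+T⋆)² ≥ q⁴/(q̂²M³) ≥ q^{3/4}` on `Δ' ≤ 3/2`)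
  — that estimate is NOT done here; this file is exact identities only.

So the main term of `stub_diag` is the asymptotic evaluation of the FIVE-VARIABLE arithmetic sum `Σ_{m₁,m₂,d₁,d₂} μμ/(ψψ) … c 𝔚_{ij}`
(KMV (24)–(29) in real variables); at `(P,Q) = (X²,1)` it is done (`…DiagXSqOne`). Helper `--supports stmt-Parity-20007`; closes
nothing; K_A, K_B and the Parity summit are NOT proved; nothing about Landau–Siegel zeros.
-/

noncomputable section

open scoped Real
open Complex Finset Polynomial MeasureTheory
open Literature.NumberTheory.LFunctions

namespace Summit.Parity.GeneralizedHardyLittlewood.Theorems.MomentsBeyondDiagonal.DiagLines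

open Summit.Parity.GeneralizedHardyLittlewood.Theorems.PrimeLevelFamEdgeIdeaDeltas.PeterssonLayers
  (spectralSum afeBox diagKernel diagPart afeW_eq_kmv)

/-! ## §1. The box condition on the line parameter is an interval -/

/-- **§1.** For nonzero `d₁, e₁, d₂, e₂`: `{t ∈ [1, N] : d₁e₁t ≤ N ∧ d₂e₂t ≤ N} = [1, min(N/(d₁e₁), N/(d₂e₂))]`. [folklore] -/
theorem lineBox_eq_Icc {d₁ e₁ d₂ e₂ : ℕ} (hD₁ : 0 < d₁ * e₁) (hD₂ : 0 < d₂ * e₂) (N : ℕ) :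
    (Finset.Icc 1 N).filter (fun t ↦ d₁ * (e₁ * t) ≤ N ∧ d₂ * (e₂ * t) ≤ N) =
      Finset.Icc 1 (min (N / (d₁ * e₁)) (N / (d₂ * e₂))) := by
  ext t
  simp only [Finset.mem_filter, Finset.mem_Icc, le_min_iff, Nat.le_div_iff_mul_le hD₁, Nat.le_div_iff_mul_le hD₂]
  constructor
  · rintro ⟨⟨h1, -⟩, h₁, h₂⟩
    refine ⟨h1, ?_, ?_⟩
    · rw [show t * (d₁ * e₁) = d₁ * (e₁ * t) by ring]; exact h₁
    · rw [show t * (d₂ * e₂) = d₂ * (e₂ * t) by ring]; exact h₂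
  · rintro ⟨h1, h₁, h₂⟩
    refine ⟨⟨h1, ?_⟩, ?_, ?_⟩
    · calc t ≤ t * (d₁ * e₁) := Nat.le_mul_of_pos_right t hD₁
        _ ≤ N := h₁
    · rw [show d₁ * (e₁ * t) = t * (d₁ * e₁) by ring]; exact h₁
    · rw [show d₂ * (e₂ * t) = t * (d₂ * e₂) by ring]; exact h₂

/-! ## §2. Interval sum + tail = the Bose double integral -/

/-- **§2.** For `y > 0`, real `A₁, A₂`, orders `i, j` and every `T`:
`Σ_{1 ≤ t ≤ T} t⁻¹𝒲_{ij}(A₁ − log t, A₂ − log t; y t²) + Σ'_{l ≥ 0} (same at t = l + 1 + T) = 𝔚_{ij}(A₁, A₂; y)`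
(`hasSum_inv_mul_logCutoffW` split at `T`). [cite: KowalskiMichelVanderKam2000, (21)–(23) p. 12–13 — derivation] -/
theorem sum_Icc_add_tsum_eq_bose {y : ℝ} (hy : 0 < y) (i j : ℕ) (A₁ A₂ : ℝ) (T : ℕ) :
    ∑ t ∈ Finset.Icc 1 T, (t : ℝ)⁻¹ *
        KMV2000.logCutoffW i j (A₁ - Real.log t) (A₂ - Real.log t) (y * (t : ℝ) ^ 2) +
      ∑' l : ℕ, ((l : ℝ) + 1 + T)⁻¹ *
        KMV2000.logCutoffW i j (A₁ - Real.log ((l : ℝ) + 1 + T)) (A₂ - Real.log ((l : ℝ) + 1 + T))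
          (y * ((l : ℝ) + 1 + T) ^ 2) =
      ∫ u₁ in Set.Ioi (0 : ℝ), (A₁ + Real.log u₁) ^ i *
        ∫ u₂ in Set.Ioi (y / u₁), Real.exp (-(u₁ + u₂)) / (1 - Real.exp (-(u₁ + u₂))) ^ 2 * (A₂ + Real.log u₂) ^ j := by
  have h := hasSum_inv_mul_logCutoffW hy i j A₁ A₂
  set f : ℕ → ℝ := fun l ↦ ((l : ℝ) + 1)⁻¹ *
    KMV2000.logCutoffW i j (A₁ - Real.log ((l : ℝ) + 1)) (A₂ - Real.log ((l : ℝ) + 1)) (y * ((l : ℝ) + 1) ^ 2) with hf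
  rw [← h.tsum_eq, ← h.summable.sum_add_tsum_nat_add T]
  congr 1
  · rw [show Finset.Icc 1 T = Finset.Ico 1 (T + 1) from rfl, Finset.sum_Ico_eq_sum_range]
    simp only [Nat.add_sub_cancel, hf]
    refine Finset.sum_congr rfl fun k _ ↦ ?_
    push_cast
    ring_nf
  · refine tsum_congr fun l ↦ ?_
    simp only [hf]
    push_cast
    ring_nf

/-! ## §3. `diagPart` = line series − box tail -/

/-- **§3. THE DIAGONAL PART = EXPLICIT LINE SERIES − EXPLICIT BOX TAIL** (every level `q`, every `P, Q, Δ'`; `M = q̂^{Δ'}`,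
`ℓ = log q̂`, `x_m = KMV2000.mollifierCoeff P M m`; per `(m₁,m₂,d₁,d₂)`: `c = gcd(m₁/d₁, m₂/d₂)`, `e₁ = (m₂/d₂)/c`, `e₂ = (m₁/d₁)/c`,
`K = (m₁/c)(m₂/c)`, `A_ν = log(q̂/(d_νe_ν))`, `y = K/q̂²`, `T⋆ = min(q²/(d₁e₁), q²/(d₂e₂))`):
`diagPart q P Q Δ' = Σ_{i,j ≤ deg Q} QᵢQⱼ ℓ^{−(i+j)}(1+(−1)^{i+j}) q̂ Σ_{m₁,m₂ ≤ M} x_{m₁}x_{m₂} Σ_{d₁∣m₁} Σ_{d₂∣m₂} c (m₁m₂)^{−1/2} ·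
   ( 𝔚_{ij}(A₁,A₂;y) − Σ'_{l≥0} (l+1+T⋆)⁻¹ 𝒲_{ij}(A₁ − log(l+1+T⋆), A₂ − log(l+1+T⋆); y(l+1+T⋆)²) )`.
[cite: KowalskiMichelVanderKam2000, (23) p. 13 — derivation] -/
theorem diagPart_eq_lineSeries_sub_tail (q : ℕ) [NeZero q] (P Q : ℝ[X]) (Δ' : ℝ) :
    diagPart q P Q Δ' =
      ∑ i ∈ range (Q.natDegree + 1), ∑ j ∈ range (Q.natDegree + 1),
        (Q.coeff i : ℂ) * (Q.coeff j : ℂ) * (((Real.log (KMV2000.qhat q))⁻¹ : ℝ) : ℂ) ^ (i + j) *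
          (1 + (-1 : ℂ) ^ (i + j)) * (KMV2000.qhat q : ℂ) *
        ∑ m₁ ∈ Finset.Icc 1 ⌊KMV2000.qhat q ^ Δ'⌋₊, ∑ m₂ ∈ Finset.Icc 1 ⌊KMV2000.qhat q ^ Δ'⌋₊,
          (KMV2000.mollifierCoeff P (KMV2000.qhat q ^ Δ') m₁ : ℂ) *
            (KMV2000.mollifierCoeff P (KMV2000.qhat q ^ Δ') m₂ : ℂ) *
          ∑ d₁ ∈ m₁.divisors, ∑ d₂ ∈ m₂.divisors,
            (((((m₁ / d₁).gcd (m₂ / d₂) : ℝ) * ((m₁ : ℝ) * m₂) ^ (-(1 / 2 : ℝ)) *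
              ((∫ u₁ in Set.Ioi (0 : ℝ),
                  (Real.log (KMV2000.qhat q / ((d₁ * (m₂ / d₂ / (m₁ / d₁).gcd (m₂ / d₂)) : ℕ) : ℝ)) + Real.log u₁) ^ i *
                  ∫ u₂ in Set.Ioi (((((m₁ / (m₁ / d₁).gcd (m₂ / d₂)) * (m₂ / (m₁ / d₁).gcd (m₂ / d₂)) : ℕ) : ℝ) /
                      KMV2000.qhat q ^ 2) / u₁),
                    Real.exp (-(u₁ + u₂)) / (1 - Real.exp (-(u₁ + u₂))) ^ 2 *
                    (Real.log (KMV2000.qhat q / ((d₂ * (m₁ / d₁ / (m₁ / d₁).gcd (m₂ / d₂)) : ℕ) : ℝ)) + Real.log u₂) ^ j) -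
              ∑' l : ℕ, ((l : ℝ) + 1 + (min (q ^ 2 / (d₁ * (m₂ / d₂ / (m₁ / d₁).gcd (m₂ / d₂))))
                  (q ^ 2 / (d₂ * (m₁ / d₁ / (m₁ / d₁).gcd (m₂ / d₂)))) : ℕ))⁻¹ *
                KMV2000.logCutoffW i j
                  (Real.log (KMV2000.qhat q / ((d₁ * (m₂ / d₂ / (m₁ / d₁).gcd (m₂ / d₂)) : ℕ) : ℝ)) -
                    Real.log ((l : ℝ) + 1 + (min (q ^ 2 / (d₁ * (m₂ / d₂ / (m₁ / d₁).gcd (m₂ / d₂))))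
                      (q ^ 2 / (d₂ * (m₁ / d₁ / (m₁ / d₁).gcd (m₂ / d₂)))) : ℕ)))
                  (Real.log (KMV2000.qhat q / ((d₂ * (m₁ / d₁ / (m₁ / d₁).gcd (m₂ / d₂)) : ℕ) : ℝ)) -
                    Real.log ((l : ℝ) + 1 + (min (q ^ 2 / (d₁ * (m₂ / d₂ / (m₁ / d₁).gcd (m₂ / d₂))))
                      (q ^ 2 / (d₂ * (m₁ / d₁ / (m₁ / d₁).gcd (m₂ / d₂)))) : ℕ)))
                  (((((m₁ / (m₁ / d₁).gcd (m₂ / d₂)) * (m₂ / (m₁ / d₁).gcd (m₂ / d₂)) : ℕ) : ℝ) / KMV2000.qhat q ^ 2) *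
                    ((l : ℝ) + 1 + (min (q ^ 2 / (d₁ * (m₂ / d₂ / (m₁ / d₁).gcd (m₂ / d₂))))
                      (q ^ 2 / (d₂ * (m₁ / d₁ / (m₁ / d₁).gcd (m₂ / d₂)))) : ℕ)) ^ 2))) : ℝ) : ℂ) := by
  have hqh : 0 < KMV2000.qhat q := KMV2000.qhat_pos_of_neZero q
  rw [diagPart_eq_sum_lines]
  refine Finset.sum_congr rfl fun i _ ↦ Finset.sum_congr rfl fun j _ ↦ ?_
  congr 1
  refine Finset.sum_congr rfl fun m₁ hm₁ ↦ Finset.sum_congr rfl fun m₂ hm₂ ↦ ?_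
  have hm₁0 : m₁ ≠ 0 := by have := (Finset.mem_Icc.mp hm₁).1; omega
  have hm₂0 : m₂ ≠ 0 := by have := (Finset.mem_Icc.mp hm₂).1; omega
  congr 1
  refine Finset.sum_congr rfl fun d₁ hd₁ ↦ Finset.sum_congr rfl fun d₂ hd₂ ↦ ?_
  have hd₁ : d₁ ∣ m₁ := (Nat.mem_divisors.mp hd₁).1
  have hd₂ : d₂ ∣ m₂ := (Nat.mem_divisors.mp hd₂).1
  have hd₁0 : d₁ ≠ 0 := fun h ↦ hm₁0 (Nat.eq_zero_of_zero_dvd (h ▸ hd₁))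
  have hd₂0 : d₂ ≠ 0 := fun h ↦ hm₂0 (Nat.eq_zero_of_zero_dvd (h ▸ hd₂))
  have ha₁0 : m₁ / d₁ ≠ 0 := fun h ↦ hm₁0 (Nat.eq_zero_of_dvd_of_div_eq_zero hd₁ h)
  have ha₂0 : m₂ / d₂ ≠ 0 := fun h ↦ hm₂0 (Nat.eq_zero_of_dvd_of_div_eq_zero hd₂ h)
  have hc0 : (m₁ / d₁).gcd (m₂ / d₂) ≠ 0 := (Nat.gcd_pos_of_pos_left _ (Nat.pos_of_ne_zero ha₁0)).ne'
  have hca : (m₁ / d₁).gcd (m₂ / d₂) ∣ m₁ := (Nat.gcd_dvd_left _ _).trans (Nat.div_dvd_of_dvd hd₁)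
  have hcb : (m₁ / d₁).gcd (m₂ / d₂) ∣ m₂ := (Nat.gcd_dvd_right _ _).trans (Nat.div_dvd_of_dvd hd₂)
  have he₁0 : m₂ / d₂ / (m₁ / d₁).gcd (m₂ / d₂) ≠ 0 := fun h ↦
    ha₂0 (Nat.eq_zero_of_dvd_of_div_eq_zero (Nat.gcd_dvd_right _ _) h)
  have he₂0 : m₁ / d₁ / (m₁ / d₁).gcd (m₂ / d₂) ≠ 0 := fun h ↦
    ha₁0 (Nat.eq_zero_of_dvd_of_div_eq_zero (Nat.gcd_dvd_left _ _) h)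
  have hK0 : (m₁ / (m₁ / d₁).gcd (m₂ / d₂)) * (m₂ / (m₁ / d₁).gcd (m₂ / d₂)) ≠ 0 :=
    mul_ne_zero (fun h ↦ hm₁0 (Nat.eq_zero_of_dvd_of_div_eq_zero hca h))
      (fun h ↦ hm₂0 (Nat.eq_zero_of_dvd_of_div_eq_zero hcb h))
  have hy : 0 < ((((m₁ / (m₁ / d₁).gcd (m₂ / d₂)) * (m₂ / (m₁ / d₁).gcd (m₂ / d₂)) : ℕ) : ℝ) / KMV2000.qhat q ^ 2) := by
    have : (0 : ℝ) < (((m₁ / (m₁ / d₁).gcd (m₂ / d₂)) * (m₂ / (m₁ / d₁).gcd (m₂ / d₂)) : ℕ) : ℝ) := by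
      exact_mod_cast Nat.pos_of_ne_zero hK0
    positivity
  -- the box on the line is the interval `[1, T⋆]`
  rw [lineBox_eq_Icc (Nat.pos_of_ne_zero (mul_ne_zero hd₁0 he₁0)) (Nat.pos_of_ne_zero (mul_ne_zero hd₂0 he₂0)) (q ^ 2)]
  -- each summand in closed real form
  rw [Finset.sum_congr rfl fun t ht ↦ weight_line_eq_logCutoffW hqh i j hm₁0 hm₂0 hd₁ hd₂
    (t := t) (by have := (Finset.mem_Icc.mp ht).1; omega), ← Complex.ofReal_sum]
  congr 1
  -- interval sum = Bose integral − tail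
  have hsplit := sum_Icc_add_tsum_eq_bose hy i j
    (Real.log (KMV2000.qhat q / ((d₁ * (m₂ / d₂ / (m₁ / d₁).gcd (m₂ / d₂)) : ℕ) : ℝ)))
    (Real.log (KMV2000.qhat q / ((d₂ * (m₁ / d₁ / (m₁ / d₁).gcd (m₂ / d₂)) : ℕ) : ℝ)))
    (min (q ^ 2 / (d₁ * (m₂ / d₂ / (m₁ / d₁).gcd (m₂ / d₂)))) (q ^ 2 / (d₂ * (m₁ / d₁ / (m₁ / d₁).gcd (m₂ / d₂)))))
  rw [← eq_sub_iff_add_eq] at hsplit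
  rw [← hsplit, Finset.mul_sum]
  refine Finset.sum_congr rfl fun t _ ↦ ?_
  ring

end Summit.Parity.GeneralizedHardyLittlewood.Theorems.MomentsBeyondDiagonal.DiagLines

end
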